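import Mathlib
import Literature.Analysis.Fourier.ErdosTuranDiscrepancy
import HarnessLib

/-!
# Teräväinen 2024, Lemma 5.6 (Erdős–Turán step): small Weyl sums force equidistribution mod 1

Support file (everything PROVED; no definitions, no named facts) towards the named fact
`Literature.NumberTheory.Sieve.teravainen2024_cor_2_1` (J. Teräväinen, *On the Liouville function
at polynomial arguments*, Amer. J. Math. 146 (2024) = arXiv:2010.07924, Corollary 2.1 ⊂
Theorem 2.6, proved in §5). In Case 2 (minor arcs) of the proof of Proposition 5.4 (§5.4, p. 15):

> **Lemma 5.6** (Erdős–Turán). Let `x ∈ 𝒳₂`. There exists a constant `C = C_k ≥ 1` such that for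
> any arc `I` of the unit circle of `ℂ` we have `𝔼_{x≤n≤x+H} 1_{e(P_x(n)) ∈ I} = |I| + O(η^{1/C})`.
>
> *Proof.* By the Erdős–Turán inequality [Montgomery], for any `1 ≤ M₀ ≤ H` we have
> `|𝔼_{x≤n≤x+H} 1_{e(P_x(n))∈I} - |I|| ≪ 1/M₀ + ∑_{1≤j≤M₀} (1/j)|𝔼_{x≤n≤x+H} e(jP_x(n))|` ((5.21)).
> Take `M₀ = η^{-1/C}` […]. Then, by the assumption `x ∈ 𝒳₂` and standard estimates for Weyl sums
> […], we get a bound of `≪ η^{1/C}` for the right-hand side of (5.21). □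

The *Erdős–Turán inequality* itself is in the tree in density form
(`Literature.Analysis.Fourier.abs_ceilCount_sub_integral_le`: Fejér-kernel constants
`24π nG/(M+1) + 4(M+1)ε/π`, with `ε` a uniform bound for the Weyl sums of orders `1 ≤ d ≤ M`
instead of the weighted sum `∑ (1/j)|·|`; immaterial here). This file specialises it to the uniform
density, i.e. proves the step "(5.21) + small Weyl sums ⟹ equidistribution" of Lemma 5.6 for an
arbitrary finite family of reals `P_n` (the "standard estimates for Weyl sums" for `x ∈ 𝒳₂`, i.e.
Weyl's inequality for minor-arc polynomial phases, are NOT formalized here and enter as the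
hypothesis `‖∑_n e(j P_n)‖ ≤ ε`, `1 ≤ j ≤ M`):

* `Teravainen2024.abs_arcCount_sub_le_of_weylSums` — for reals `a ≤ b`,
  `|#{(n,k) : a ≤ P_n + k < b} - N(b-a)| ≤ 12N/(M+1) + 4(M+1)ε/π`, the count written as
  `∑_n (⌈b - P_n⌉ - ⌈a - P_n⌉)`;
* `Teravainen2024.ceil_sub_ceil_eq_indicator` — for `b - a ≤ 1` the summand is the indicator of
  "`P_n ∈ [a,b)` mod `1`";
* `Teravainen2024.arcDensity_le_of_weylSums` — the form (5.23) feeding Lemma 5.7: the proportion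
  of `n` with `P_n ∈ [a, b)` mod `1` is `≤ (b - a) + 12/(M+1) + 4(M+1)ε/(πN)`.

## References
* J. Teräväinen, Amer. J. Math. 146 (2024), no. 4, 1115–1167, §5.4, Lemma 5.6 and (5.21), (5.23)
  (arXiv:2010.07924, p. 15). [Teravainen2024]
* H. L. Montgomery, *Ten lectures on the interface between analytic number theory and harmonic
  analysis*, CBMS 84 (1994), Ch. 1 (Erdős–Turán inequality) — the reference [Montgomery] there.
-/

noncomputable section

open Finset Complex MeasureTheory intervalIntegral
open scoped Classical

namespace Literature.NumberTheory.Sieve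

namespace Teravainen2024

/-! ### The uniform density on `[-π, π]` -/

/-- `∫_{-π}^{π} sin(d u) du = 0` for an integer `d ≠ 0`. [folklore] -/
theorem integral_sin_int_mul {d : ℤ} (hd : d ≠ 0) :
    ∫ u in (-Real.pi)..Real.pi, Real.sin (d * u) = 0 := by
  have hd' : (d : ℝ) ≠ 0 := Int.cast_ne_zero.mpr hd
  rw [intervalIntegral.integral_comp_mul_left (fun x => Real.sin x) hd', integral_sin]
  have h : Real.cos (d * -Real.pi) = Real.cos (d * Real.pi) := by
    rw [mul_neg, Real.cos_neg]
  rw [h, sub_self, smul_zero]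

/-- Weyl sums control cosine and sine sums: `‖∑_n e(j P_n)‖ ≤ ε` gives
`|∑_n cos(j·2πP_n)| ≤ ε` and `|∑_n sin(j·2πP_n)| ≤ ε`. [folklore] -/
theorem abs_sum_cos_sin_le_of_norm_sum_exp_le {ι : Type*} (s : Finset ι) (P : ι → ℝ) (j : ℕ)
    {ε : ℝ} (h : ‖∑ n ∈ s, Complex.exp (2 * Real.pi * I * j * (P n : ℂ))‖ ≤ ε) :
    |∑ n ∈ s, Real.cos (j * (2 * Real.pi * P n))| ≤ ε ∧
      |∑ n ∈ s, Real.sin (j * (2 * Real.pi * P n))| ≤ ε := by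
  set S : ℂ := ∑ n ∈ s, Complex.exp (2 * Real.pi * I * j * (P n : ℂ)) with hS
  have hre : S.re = ∑ n ∈ s, Real.cos (j * (2 * Real.pi * P n)) := by
    rw [hS, Complex.re_sum]
    refine Finset.sum_congr rfl fun n _ => ?_
    have h1 : 2 * Real.pi * I * j * (P n : ℂ) = ((j * (2 * Real.pi * P n) : ℝ) : ℂ) * I := by
      push_cast
      ring
    rw [h1, Complex.exp_ofReal_mul_I_re]
  have him : S.im = ∑ n ∈ s, Real.sin (j * (2 * Real.pi * P n)) := by
    rw [hS, Complex.im_sum]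
    refine Finset.sum_congr rfl fun n _ => ?_
    have h1 : 2 * Real.pi * I * j * (P n : ℂ) = ((j * (2 * Real.pi * P n) : ℝ) : ℂ) * I := by
      push_cast
      ring
    rw [h1, Complex.exp_ofReal_mul_I_im]
  rw [← hre, ← him]
  exact ⟨(Complex.abs_re_le_norm S).trans h, (Complex.abs_im_le_norm S).trans h⟩

/-! ### Lemma 5.6: equidistribution from small Weyl sums -/

/-- **Teräväinen 2024, Lemma 5.6 (Erdős–Turán step), counting form.** Let `P_n` (`n ∈ ι`,
`N = #ι`) be reals whose Weyl sums satisfy `‖∑_n e(j P_n)‖ ≤ ε` for `1 ≤ j ≤ M`. Then for all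
reals `a, b`, `|∑_n (⌈b - P_n⌉ - ⌈a - P_n⌉) - N (b - a)| ≤ 12 N/(M+1) + 4(M+1)ε/π`; here
`⌈b - P_n⌉ - ⌈a - P_n⌉ = #{k ∈ ℤ : a ≤ P_n + k < b}` counts the visits of `P_n` mod `1` to the arc
`[a, b)`. (The tree's Fejér-kernel Erdős–Turán inequality
`Literature.Analysis.Fourier.abs_ceilCount_sub_integral_le` with the uniform density `1/2π` and the
angles `θ_n = 2πP_n`.) [cite: Teravainen2024, Lemma 5.6 and (5.21)] -/
theorem abs_arcCount_sub_le_of_weylSums {ι : Type*} [Fintype ι] (P : ι → ℝ) {M : ℕ} {ε : ℝ}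
    (hε : 0 ≤ ε)
    (hW : ∀ j : ℕ, 1 ≤ j → j ≤ M → ‖∑ n, Complex.exp (2 * Real.pi * I * j * (P n : ℂ))‖ ≤ ε)
    (a b : ℝ) :
    |(∑ n, (⌈b - P n⌉ - ⌈a - P n⌉ : ℤ) : ℝ) - Fintype.card ι * (b - a)|
      ≤ 12 * Fintype.card ι / (M + 1) + 4 * (M + 1) * ε / Real.pi := by
  have hπ := Real.pi_pos
  set g : ℝ → ℝ := fun _ => 1 / (2 * Real.pi) with hg
  set θ : ι → ℝ := fun n => 2 * Real.pi * P n with hθ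
  have hgc : Continuous g := continuous_const
  have hper : Function.Periodic g (2 * Real.pi) := fun _ => rfl
  have hone : ∫ x in (-Real.pi)..Real.pi, g x = 1 := by
    rw [hg, intervalIntegral.integral_const]
    simp only [smul_eq_mul]
    field_simp
    ring
  have hG : ∀ x, g x ≤ 1 / (2 * Real.pi) := fun _ => le_rfl
  have hF : ∀ d : ℕ, 1 ≤ d → d ≤ M →
      |∑ j, Real.cos (d * θ j) - Fintype.card ι * ∫ t in (-Real.pi)..Real.pi, g t * Real.cos (d * t)| ≤ ε ∧
      |∑ j, Real.sin (d * θ j) - Fintype.card ι * ∫ t in (-Real.pi)..Real.pi, g t * Real.sin (d * t)| ≤ ε := by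
    intro d hd1 hdM
    have hd0 : (d : ℤ) ≠ 0 := by omega
    have hcos : ∫ t in (-Real.pi)..Real.pi, g t * Real.cos (d * t) = 0 := by
      rw [hg]
      simp only
      rw [intervalIntegral.integral_const_mul]
      have h := Literature.Analysis.Fourier.integral_cos_int_mul hd0
      push_cast at h
      rw [h, mul_zero]
    have hsin : ∫ t in (-Real.pi)..Real.pi, g t * Real.sin (d * t) = 0 := by
      rw [hg]
      simp only
      rw [intervalIntegral.integral_const_mul]
      have h := integral_sin_int_mul hd0
      push_cast at h
      rw [h, mul_zero]
    rw [hcos, hsin, mul_zero, sub_zero, sub_zero]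
    have h := abs_sum_cos_sin_le_of_norm_sum_exp_le Finset.univ P d (hW d hd1 hdM)
    simp only [hθ]
    exact h
  have h := Literature.Analysis.Fourier.abs_ceilCount_sub_integral_le θ hgc hper hone
    (by positivity : (0 : ℝ) ≤ 1 / (2 * Real.pi)) hG hε hF (2 * Real.pi * a) (2 * Real.pi * b)
  -- translate the count and the main term
  have hcount : ∀ n, (⌈(2 * Real.pi * b - θ n) / (2 * Real.pi)⌉ - ⌈(2 * Real.pi * a - θ n) / (2 * Real.pi)⌉ : ℤ)
      = ⌈b - P n⌉ - ⌈a - P n⌉ := by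
    intro n
    have h1 : (2 * Real.pi * b - θ n) / (2 * Real.pi) = b - P n := by
      rw [hθ]
      field_simp
    have h2 : (2 * Real.pi * a - θ n) / (2 * Real.pi) = a - P n := by
      rw [hθ]
      field_simp
    rw [h1, h2]
  have hmain : (Fintype.card ι : ℝ) * ∫ x in (2 * Real.pi * a)..(2 * Real.pi * b), g x =
      Fintype.card ι * (b - a) := by
    rw [hg, intervalIntegral.integral_const]
    simp only [smul_eq_mul]
    field_simp
  simp only [hcount] at h
  rw [hmain] at h
  refine h.trans (le_of_eq ?_)
  field_simp
  ring

/-- For an arc of length `≤ 1` each point is counted at most once: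
`⌈b - P⌉ - ⌈a - P⌉ = 1` if `a ≤ P + k < b` for some integer `k`, and `= 0` otherwise
(`a ≤ b ≤ a + 1`). [folklore] -/
theorem ceil_sub_ceil_eq_indicator {a b : ℝ} (hab : a ≤ b) (hba : b ≤ a + 1) (P : ℝ) :
    ((⌈b - P⌉ - ⌈a - P⌉ : ℤ) : ℝ) = if ∃ k : ℤ, a ≤ P + k ∧ P + k < b then 1 else 0 := by
  have h1 : ⌈a - P⌉ ≤ ⌈b - P⌉ := Int.ceil_le_ceil (by linarith)
  have h2 : ⌈b - P⌉ ≤ ⌈a - P⌉ + 1 := by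
    have : ⌈b - P⌉ ≤ ⌈(a - P) + 1⌉ := Int.ceil_le_ceil (by linarith)
    rwa [Int.ceil_add_one] at this
  split_ifs with hk
  · obtain ⟨k, hk1, hk2⟩ := hk
    -- `k ≥ a - P` so `⌈a - P⌉ ≤ k`, and `k < b - P` so `k + 1 ≤ ⌈b - P⌉`
    have h3 : ⌈a - P⌉ ≤ k := Int.ceil_le.mpr (by linarith)
    have h4 : k + 1 ≤ ⌈b - P⌉ := by
      have : (k : ℝ) < b - P := by linarith
      have := Int.lt_ceil.mpr this
      omega
    have h5 : ⌈b - P⌉ - ⌈a - P⌉ = 1 := by omega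
    rw [h5]
    simp
  · -- no integer in `[a - P, b - P)`: the two ceilings agree
    push Not at hk
    have h5 : ⌈b - P⌉ = ⌈a - P⌉ := by
      by_contra hne
      have h6 : ⌈b - P⌉ = ⌈a - P⌉ + 1 := by omega
      -- then `k = ⌈a - P⌉` lies in `[a - P, b - P)`
      have hk1 : a ≤ P + ⌈a - P⌉ := by linarith [Int.le_ceil (a - P)]
      have hk2 : P + ⌈a - P⌉ < b := by
        have := Int.ceil_lt_add_one (b - P)
        have h7 : ((⌈b - P⌉ : ℤ) : ℝ) = ⌈a - P⌉ + 1 := by rw [h6]; push_cast; ring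
        -- `b - P > ⌈b - P⌉ - 1 = ⌈a - P⌉`
        have h8 : ((⌈a - P⌉ : ℤ) : ℝ) < b - P := by
          have := Int.lt_ceil.mp (show ⌈a - P⌉ < ⌈b - P⌉ by omega)
          exact this
        linarith
      exact absurd hk2 (not_lt.mpr (hk ⌈a - P⌉ hk1))
    rw [h5, sub_self]
    simp

/-- **Teräväinen 2024, (5.23) (the density of visits to an arc).** Under the Weyl-sum hypothesis
of `abs_arcCount_sub_le_of_weylSums`, for an arc `[a, b)` of length `b - a ≤ 1` the proportion of
`n` with `P_n ∈ [a, b)` mod `1` is at most `(b - a) + 12/(M+1) + 4(M+1)ε/(πN)` (`N = #ι ≥ 1`).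
[cite: Teravainen2024, §5.4 (5.23) via Lemma 5.6] -/
theorem arcDensity_le_of_weylSums {ι : Type*} [Fintype ι] [Nonempty ι] (P : ι → ℝ) {M : ℕ}
    {ε : ℝ} (hε : 0 ≤ ε)
    (hW : ∀ j : ℕ, 1 ≤ j → j ≤ M → ‖∑ n, Complex.exp (2 * Real.pi * I * j * (P n : ℂ))‖ ≤ ε)
    {a b : ℝ} (hab : a ≤ b) (hba : b ≤ a + 1) :
    (#(Finset.univ.filter fun n : ι => ∃ k : ℤ, a ≤ P n + k ∧ P n + k < b) : ℝ) / Fintype.card ι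
      ≤ (b - a) + 12 / (M + 1) + 4 * (M + 1) * ε / (Real.pi * Fintype.card ι) := by
  classical
  have hN : (0 : ℝ) < Fintype.card ι := by exact_mod_cast Fintype.card_pos
  have hπ := Real.pi_pos
  have h := abs_arcCount_sub_le_of_weylSums P hε hW a b
  have hcount : (∑ n, (((⌈b - P n⌉ : ℤ) : ℝ) - ((⌈a - P n⌉ : ℤ) : ℝ))) =
      #(Finset.univ.filter fun n : ι => ∃ k : ℤ, a ≤ P n + k ∧ P n + k < b) := by
    rw [Finset.card_filter]
    push_cast
    refine Finset.sum_congr rfl fun n _ => ?_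
    rw [← Int.cast_sub, ceil_sub_ceil_eq_indicator hab hba (P n)]
  push_cast at h
  rw [hcount] at h
  have h2 := (abs_le.mp h).2
  rw [div_le_iff₀ hN]
  have e : ((b - a) + 12 / (M + 1) + 4 * (M + 1) * ε / (Real.pi * Fintype.card ι)) * Fintype.card ι
      = Fintype.card ι * (b - a) + (12 * Fintype.card ι / (M + 1) + 4 * (M + 1) * ε / Real.pi) := by
    field_simp
    ring
  rw [e]
  linarith

end Teravainen2024

end Literature.NumberTheory.Sieve
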